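import Summits.CriticalPhenomena.CardyFormulaZ2.Theorems.CardyBoundaryCoulombGasHalfPlaneMarkDensityLawWindowSecondMark
import Summits.CriticalPhenomena.CardyFormulaZ2.Theorems.CardyBoundaryCoulombGasHalfPlaneMarkDensityLawSymmetry

/-!
# `HalfPlaneMarkDensityLaw` (crux stmt-CriticalPhenomena-5661), line `Sketch`, lead c12-0, wave 2 assembly, part 3:
# joint subsequential limits are strictly monotone in EVERY mark

From strict monotonicity in the fourth mark (`Window.stub_jointLimit_strictMono`, `…WindowLowerBound.lean`),
in the second mark (`Window.stub_jointLimit_strictMono_second`, `…WindowSecondMark.lean`) and the exact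
reflection symmetry of joint subsequential limits `G(−y,−c,−b,−a) = G(a,b,c,y)`
(`Subseq.reflect_of_jointLimit`, `…Symmetry.lean`): every joint subsequential scaling limit `G` of the
half-plane four-arc crossing probability `P_n(a,b,c,y) = P_{1/2}[[⌊an⌋,⌊bn⌋]×{0} ↔ [⌊cn⌋,⌊yn⌋]×{0} in ℤ×ℕ]`
of critical bond-`ℤ²` is STRICTLY DECREASING in the first mark (`stub_jointLimit_strictAnti_first`) and in
the third mark (`stub_jointLimit_strictAnti_third`) — altogether strictly monotone in each of its four
marks on the chamber `{a < b < c < y}` (the tree had the non-strict monotonicity `Subseq.jointLimit_mono`).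
-/

noncomputable section

namespace Summit.CriticalPhenomena.CardyFormulaZ2.Cruxes.HalfPlaneMarkDensityLaw.SketchLine

open Literature.Probability.Percolation Literature.Probability.LatticeModels
open MeasureTheory Filter Set SimpleGraph
open scoped Topology
open Summit.CriticalPhenomena.CardyFormulaZ2.Theorems.HalfPlaneMarkDensityLaw.Negative

namespace Window

/-- **STUB (registered signature): joint subsequential limits are STRICTLY DECREASING in the first mark**
(a longer source arc to the left is strictly better): `G(a,b,c,y) < G(a',b,c,y)` for `a' < a`. [folklore] -/
theorem stub_jointLimit_strictAnti_first :
    ∀ {θ : ℕ → ℕ} {G : ℝ → ℝ → ℝ → ℝ → ℝ},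
      (∀ a b c y : ℝ, a < b → b < c → c < y →
        Tendsto (fun n ↦ μ.real (openCrossing halfPlane (arcA a b (θ n))
          (rowIcc ⌊c * (θ n : ℕ)⌋ ⌊y * (θ n : ℕ)⌋))) atTop (𝓝 (G a b c y))) →
      StrictMono θ → ∀ {a' a b c y : ℝ}, a' < a → a < b → b < c → c < y → G a b c y < G a' b c y := by
  intro θ G hG hθ a' a b c y ha'a hab hbc hcy
  rw [← Subseq.reflect_of_jointLimit hG hθ hab hbc hcy,
    ← Subseq.reflect_of_jointLimit hG hθ (ha'a.trans hab) hbc hcy]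
  exact stub_jointLimit_strictMono hG hθ (by linarith) (by linarith) (by linarith) (by linarith)

/-- **STUB (registered signature): joint subsequential limits are STRICTLY DECREASING in the third mark**
(a longer target arc to the left is strictly better): `G(a,b,c,y) < G(a,b,c',y)` for `c' < c`. [folklore] -/
theorem stub_jointLimit_strictAnti_third :
    ∀ {θ : ℕ → ℕ} {G : ℝ → ℝ → ℝ → ℝ → ℝ},
      (∀ a b c y : ℝ, a < b → b < c → c < y →
        Tendsto (fun n ↦ μ.real (openCrossing halfPlane (arcA a b (θ n))
          (rowIcc ⌊c * (θ n : ℕ)⌋ ⌊y * (θ n : ℕ)⌋))) atTop (𝓝 (G a b c y))) →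
      StrictMono θ → ∀ {a b c' c y : ℝ}, a < b → b < c' → c' < c → c < y → G a b c y < G a b c' y := by
  intro θ G hG hθ a b c' c y hab hbc' hc'c hcy
  rw [← Subseq.reflect_of_jointLimit hG hθ hab (hbc'.trans hc'c) hcy,
    ← Subseq.reflect_of_jointLimit hG hθ hab hbc' (hc'c.trans hcy)]
  exact stub_jointLimit_strictMono_second hG hθ (by linarith) (by linarith) (by linarith) (by linarith)

end Window

end Summit.CriticalPhenomena.CardyFormulaZ2.Cruxes.HalfPlaneMarkDensityLaw.SketchLine
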